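/-
Origin: expansion seat `prover-pub-hodgecm-mc-carch-1-g4-0`, handover #CA44 r2 2026-08-20T10:40Z md5 72eb164fec34 (388 l., 10 decls; NEW additive leaf; imports installed RUN-43 #CA27 Model.ArchKTypeOfDefiniteChar + #CA46 (this kit); RUN 49; INSTALL after #CA46; drops with #CA46; cert certs/ax-ArchKTypeOfDefiniteChar34-72eb164fec34.log: rc 0 / 39 s / 0 warnings / trio) (`HOME/mc/pub-hodgecm-mc-carch-1/pkg49/HodgeCM/Model/ArchKTypeOfDefiniteChar34.lean`, md5 72eb164fec34, 388 lines);
landed by the gen-19 packager (p-g19) in gate run 49 as `HodgeCM/Model/ArchKTypeOfDefiniteChar34.lean` (verbatim).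
-/
/-
Copyright (c) 2026. Released under Apache 2.0 license as described in the file LICENSE.
Cell pub-hodgecm, MODEL layer (construction prover mc-carch-1, gen 4), BINDER-OWNERS row 12 `C`, residual (c5) for the
CONJUGATED-plane lines k = 2, 3 at the G pins: the (34) twin of RUN-43 #CA27 `ArchKTypeOfDefiniteChar`.
-/
import Summits.HodgeConjecture.HodgeCM.Model.ArchKTypeOfDefiniteChar
import Summits.HodgeConjecture.HodgeCM.Model.ArchKTypeOfAtCoset

/-!
# (c5) for lines 2 and 3 from the definite type of the line scalar: `harch_two/three_of_defTypeG`

Verbatim #CA27 on the conjugated-plane lines: by K-1 `cmConjLineRepFin₀/₁_apply_eq_smul_cmPairRep` the line reps `k = 2, 3` are, on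
`U(V)(𝔸) × U(1)`, the line pairs `(V, ⟨dW' c.D k⟩)` (splittings `hGR₂/hGR₃`) twisted by `η₂·cmConjLineChar₀` / `η₃·cmConjLineChar₁`.
So: `archScalar_twoG/threeG` (the line scalars on archimedean elements of `U(diag frameD V)`), `lineRepOf_two/three_regime_archToAdelicG`
(the line at an archimedean regime element is `(c_k(a′) • ω_∞(a′,1)) ⊗ 1`), and **`harch_two/three_of_defTypeG (x₀) (N) (a) (hω) (hdef)`** —
LITERALLY the `harch` input of #CA43 `archKTypeOfSlotTwoAtG/ThreeAtG` (any centre `x₀`), from the per-place vacuum exponents `hω` (#CA20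
`exists_defExponent_blockFamilyOfAt` at `hGR₂/hGR₃`) and the type identity `hdef` («`c_k(archSingle u) · det(u)^{a b} = 1`», the R2-pin
read-off).
Nothing is cited and nothing is minted; 0 records, 0 `def … : Prop`.
-/

set_option autoImplicit false

noncomputable section

open NumberField NumberField.InfinitePlace NumberField.mixedEmbedding IsDedekindDomain
open scoped Matrix TensorProduct Classical SchwartzMap
open MvPolynomial
open Literature.AlgebraicGeometry.HodgeTheory
open Literature.NumberTheory.Automorphic Literature.NumberTheory.Automorphic.UnitaryGroup Literature.NumberTheory.Weil1964
open Literature.RepresentationTheory.KonnoKonno2007 Literature.RepresentationTheory.KonnoKonno2007.RealDualPair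
open Literature.NumberTheory.GelbartRogawski1991 Literature.NumberTheory.GelbartRogawski1991.UnitaryDualPair
open Literature.RepresentationTheory (atPlace)
open Literature.Analysis.SegalBargmann
open HodgeCM.Adelic HodgeCM.PerL34 HodgeCM.Model.HypCensus HodgeCM.Model.SupplyInstance HodgeCM.Model.ArchSideTerm

namespace HodgeCM.Model
section HarchPinChar

variable {L : CMField} {ι₁ : L →+* ℂ} (V : HermSpace3 L ι₁) (S : StubTree.SeesawDatum L)
variable
  (hGR : (cmSplittingDatum (L : Type) finProdFinEquiv (frameD V) (frameD_real V) (frameD_ne V) (dW S) (dW_real S) (dW_ne S)).CompatibleSplitting)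
  (hGR₀ : (cmSplittingDatum (L : Type) (e₁) (frameD V) (frameD_real V) (frameD_ne V) (lineVec (L : Type) (dW S 0))
    (fun _ => dW_real S 0) (fun _ => dW_ne S 0)).CompatibleSplitting)
  (hGR₁ : (cmSplittingDatum (L : Type) (e₁) (frameD V) (frameD_real V) (frameD_ne V) (lineVec (L : Type) (dW S 1))
    (fun _ => dW_real S 1) (fun _ => dW_ne S 1)).CompatibleSplitting)
  (hGR₂ : (cmSplittingDatum (L : Type) (e₁) (frameD V) (frameD_real V) (frameD_ne V) (lineVec (L : Type) (dW' S 0))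
    (fun _ => dW'_real S 0) (fun _ => dW'_ne S 0)).CompatibleSplitting)
  (hGR₃ : (cmSplittingDatum (L : Type) (e₁) (frameD V) (frameD_real V) (frameD_ne V) (lineVec (L : Type) (dW' S 1))
    (fun _ => dW'_real S 1) (fun _ => dW'_ne S 1)).CompatibleSplitting)
  (η₀ η₁ η₂ η₃ : CMAdelic (L : Type) (frameD V) × CMAdelicOne (L : Type) →* ℂˣ)
  (hV : IsAnisotropic L V.Hm)

/-! ### line 2 (conjugated plane) -/

/-- **the scalar of line 2 on archimedean elements of `U(diag frameD V)`**: `x ↦ η₂(x^𝔸, 1) · χ₂′(x^𝔸, 1)` (its pull-back along the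
`ι₁`-section `archSectionFrameOf V` is #CA3's `lineScalar_two`). -/
def archScalar_twoG : UnitaryGroup.arch (↥(maximalRealSubfield L)) L (IsCMField.complexConj L) 3 (Matrix.diagonal (frameD V)) →* ℂˣ :=
  (η₂.comp (MonoidHom.prod
      (UnitaryGroup.archToAdelic (↥(maximalRealSubfield L)) L (IsCMField.complexConj L) 3 (Matrix.diagonal (frameD V))) 1)) *
    ((cmConjLineChar₀ (L : Type) finProdFinEquiv e₁ (frameD V) (frameD_real V) (frameD_ne V) (dW S) (dW_real S) (dW_ne S) (dW' S) (dW'_real S) (dW'_ne S) S.isoGL (isoGL_hg₀ S) hGR hGR₂ hGR₃).comp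
      (MonoidHom.prod (UnitaryGroup.archToAdelic (↥(maximalRealSubfield L)) L (IsCMField.complexConj L) 3 (Matrix.diagonal (frameD V))) 1))

/-- (Ported verbatim from the HodgeCMPerL package; no docstring in the source.) -/
theorem archScalar_two_applyG (x : UnitaryGroup.arch (↥(maximalRealSubfield L)) L (IsCMField.complexConj L) 3 (Matrix.diagonal (frameD V))) :
    archScalar_twoG V S hGR hGR₂ hGR₃ η₂ x =
      η₂ (UnitaryGroup.archToAdelic (↥(maximalRealSubfield L)) L (IsCMField.complexConj L) 3 (Matrix.diagonal (frameD V)) x, 1) *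
        cmConjLineChar₀ (L : Type) finProdFinEquiv e₁ (frameD V) (frameD_real V) (frameD_ne V) (dW S) (dW_real S) (dW_ne S) (dW' S) (dW'_real S) (dW'_ne S) S.isoGL (isoGL_hg₀ S) hGR hGR₂ hGR₃
          (UnitaryGroup.archToAdelic (↥(maximalRealSubfield L)) L (IsCMField.complexConj L) 3 (Matrix.diagonal (frameD V)) x, 1) :=
  rfl

/-- **line 2 at an ARCHIMEDEAN regime element**: `lineRepD 0 ((a)^𝔸, 1) = (c₀(a′) • ω_∞((a′, 1))) ⊗ 1`, `a′ = archFrameCongr (frameG V) a`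
(#CA2 `smul_cmPairRep_archToAdelic_eq_adelicTensorEnd` + the line collapse, as in #CA3 for the `ι₁`-section). -/
theorem lineRepOf_two_regime_archToAdelicG (a : UnitaryGroup.arch (↥(maximalRealSubfield L)) L (IsCMField.complexConj L) 3 V.Hm) :
    lineRepOf V S hGR hGR₀ hGR₁ hGR₂ hGR₃ η₀ η₁ η₂ η₃ 2
        (HodgeCM.Adelic.regimeEquiv L V.Hm hV
          (UnitaryGroup.archToAdelic (↥(maximalRealSubfield L)) L (IsCMField.complexConj L) 3 V.Hm a), 1) =
      adelicTensorEnd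
        (((archScalar_twoG V S hGR hGR₂ hGR₃ η₂ (archFrameCongr (L : Type) V.Hm (frameG V) (frameD V) (frame_congr V) a) : ℂˣ) : ℂ) •
          (cmArchWeilRep (L : Type) e₁ (frameD V) (frameD_real V) (frameD_ne V) (lineVec (L : Type) (dW' S 0))
            (fun _ => dW'_real S 0) (fun _ => dW'_ne S 0) hGR₂ (archFrameCongr (L : Type) V.Hm (frameG V) (frameD V) (frame_congr V) a, 1) :
              𝓢((Fin 3 → mixedSpace (↥(maximalRealSubfield L))), ℂ) →ₗ[ℂ] _))
        LinearMap.id := by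
  have h1 : lineRepOf V S hGR hGR₀ hGR₁ hGR₂ hGR₃ η₀ η₁ η₂ η₃ 2
        (HodgeCM.Adelic.regimeEquiv L V.Hm hV
          (UnitaryGroup.archToAdelic (↥(maximalRealSubfield L)) L (IsCMField.complexConj L) 3 V.Hm a), 1) =
      cmConjLineRepFin₀ (L : Type) finProdFinEquiv e₁ (frameD V) (frameD_real V) (frameD_ne V) (dW S) (dW_real S) (dW_ne S) (dW' S) (dW'_real S)
        (dW'_ne S) S.isoGL (isoGL_hg₀ S) hGR hGR₂ hGR₃ η₂
        (UnitaryGroup.archToAdelic (↥(maximalRealSubfield L)) L (IsCMField.complexConj L) 3 (Matrix.diagonal (frameD V))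
          (archFrameCongr (L : Type) V.Hm (frameG V) (frameD V) (frame_congr V) a), 1) := by
    rw [← cmFrameEquiv_regime_archToAdelic V hV a]
    rfl
  have key := smul_cmPairRep_archToAdelic_eq_adelicTensorEnd (L : Type) e₁ (frameD V) (frameD_real V) (frameD_ne V)
    (lineVec (L : Type) (dW' S 0)) (fun _ => dW'_real S 0) (fun _ => dW'_ne S 0) hGR₂
    ((archScalar_twoG V S hGR hGR₂ hGR₃ η₂ (archFrameCongr (L : Type) V.Hm (frameG V) (frameD V) (frame_congr V) a) : ℂˣ) : ℂ)
    (archFrameCongr (L : Type) V.Hm (frameG V) (frameD V) (frame_congr V) a) 1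
  rw [map_one] at key
  rw [h1, ← key]
  refine LinearMap.ext fun φ => ?_
  rw [cmConjLineRepFin₀_apply_eq_smul_cmPairRep, LinearMap.smul_apply, map_one, map_one]
  rfl

variable {S' : Type} [Fintype S'] [DecidableEq S']
  (eR : PosIdx (cmXW (L : Type) (frameD V) (lineVec (L : Type) (dW' S 0)) (fun _ => dW'_real S 0) ι₁ (HypCensus.cmPlace (L : Type) ι₁)) ≃ Unit)
  (eS : NegIdx (cmXW (L : Type) (frameD V) (lineVec (L : Type) (dW' S 0)) (fun _ => dW'_real S 0) ι₁ (HypCensus.cmPlace (L : Type) ι₁)) ≃ S')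

/-- **(c5) FOR LINE 2 FROM THE DEFINITE TYPE OF THE LINE SCALAR.**  If at every real place `b ≠ v₁` the line-2 scalar `c₀ = η₀·χ₀` kills the
vacuum exponent of the pair `(diag frameD V, ⟨a₀⟩)` there (`c₀((archSingle (w b) u)) · det(u)^{a b} = 1`, with `a` the exponent function of
`exists_defExponent_blockFamilyOfAt`, supplied as the hypothesis `hω`), then every archimedean `aa ∈ U(V.Hm)(L ⊗ ℝ)` with trivial
`w(ι₁)`-component fixes every `φ_N(Φarch ℓ)` under `lineRepD … 0` — LITERALLY the `harch` input of the row-12 term (#CA13–#CA19) for line 2. -/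
theorem harch_two_of_defTypeG (x₀ : Fin 3 → ↥(maximalRealSubfield L)) (N : ℕ)
    (a : {v : InfinitePlace ↥(maximalRealSubfield L) // v.IsReal} → ℤ)
    (hω : ∀ b : {v : InfinitePlace ↥(maximalRealSubfield L) // v.IsReal}, b ≠ HypCensus.cmPlace (L : Type) ι₁ →
      ∀ (u : UnitaryGroup.archLocal (L : Type) 3 (Matrix.diagonal (frameD V)) (cmPlaceOver (L : Type) b)) (ℓ : Module.Dual ℂ (Fin 2 → ℂ)),
        cmArchWeilRep (L : Type) e₁ (frameD V) (frameD_real V) (frameD_ne V) (lineVec (L : Type) (dW' S 0)) (fun _ => dW'_real S 0)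
            (fun _ => dW'_ne S 0) hGR₂
            (UnitaryGroup.archSingle (↥(maximalRealSubfield L)) L (IsCMField.complexConj L) 3 (Matrix.diagonal (frameD V))
              (IsCMField.complexConj_ne_one L) (NumberField.complexConj_smul_infinitePlace (L : Type)) (cmPlaceOver (L : Type) b) u, 1)
            (blockFamilyOfAt (L : Type) e₁ (frameD V) (frameD_real V) (frameD_ne V) (lineVec (L : Type) (dW' S 0)) (fun _ => dW'_real S 0)
              (fun _ => dW'_ne S 0) ι₁ (blockPosEquiv V) (blockNegEquiv V) eR eS (degOnePDual S') (binvPi 1) ℓ) =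
          (((u : UnitaryGroup.archLocal (L : Type) 3 (Matrix.diagonal (frameD V)) (cmPlaceOver (L : Type) b)) : GL (Fin 3) ℂ) :
              Matrix (Fin 3) (Fin 3) ℂ).det ^ a b •
            blockFamilyOfAt (L : Type) e₁ (frameD V) (frameD_real V) (frameD_ne V) (lineVec (L : Type) (dW' S 0)) (fun _ => dW'_real S 0)
              (fun _ => dW'_ne S 0) ι₁ (blockPosEquiv V) (blockNegEquiv V) eR eS (degOnePDual S') (binvPi 1) ℓ)
    (hdef : ∀ b : {v : InfinitePlace ↥(maximalRealSubfield L) // v.IsReal}, b ≠ HypCensus.cmPlace (L : Type) ι₁ →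
      ∀ u : UnitaryGroup.archLocal (L : Type) 3 (Matrix.diagonal (frameD V)) (cmPlaceOver (L : Type) b),
        ((archScalar_twoG V S hGR hGR₂ hGR₃ η₂
            (UnitaryGroup.archSingle (↥(maximalRealSubfield L)) L (IsCMField.complexConj L) 3 (Matrix.diagonal (frameD V))
              (IsCMField.complexConj_ne_one L) (NumberField.complexConj_smul_infinitePlace (L : Type)) (cmPlaceOver (L : Type) b) u) : ℂˣ) : ℂ) *
          (((u : UnitaryGroup.archLocal (L : Type) 3 (Matrix.diagonal (frameD V)) (cmPlaceOver (L : Type) b)) : GL (Fin 3) ℂ) :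
              Matrix (Fin 3) (Fin 3) ℂ).det ^ a b = 1) :
    ∀ aa : UnitaryGroup.arch (↥(maximalRealSubfield L)) L (IsCMField.complexConj L) 3 V.Hm,
      UnitaryGroup.archAt (↥(maximalRealSubfield L)) L (IsCMField.complexConj L) 3 V.Hm (UnitaryGroup.cmPlace (L : Type) ι₁)
          (NumberField.complexConj_smul_infinitePlace (L : Type) _) (IsCMField.complexConj_ne_one (L : Type)) aa = 1 →
      ∀ ℓ : Module.Dual ℂ (Fin 2 → ℂ),
        lineRepOf V S hGR hGR₀ hGR₁ hGR₂ hGR₃ η₀ η₁ η₂ η₃ 2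
            (HodgeCM.Adelic.regimeEquiv L V.Hm hV
              (UnitaryGroup.archToAdelic (↥(maximalRealSubfield L)) L (IsCMField.complexConj L) 3 V.Hm aa), 1)
            (testFun (↥(maximalRealSubfield L)) (Fin 3)
              (blockFamilyOfAt (L : Type) e₁ (frameD V) (frameD_real V) (frameD_ne V) (lineVec (L : Type) (dW' S 0)) (fun _ => dW'_real S 0)
                (fun _ => dW'_ne S 0) ι₁ (blockPosEquiv V) (blockNegEquiv V) eR eS (degOnePDual S') (binvPi 1) ℓ) x₀ N) =
          testFun (↥(maximalRealSubfield L)) (Fin 3)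
            (blockFamilyOfAt (L : Type) e₁ (frameD V) (frameD_real V) (frameD_ne V) (lineVec (L : Type) (dW' S 0)) (fun _ => dW'_real S 0)
              (fun _ => dW'_ne S 0) ι₁ (blockPosEquiv V) (blockNegEquiv V) eR eS (degOnePDual S') (binvPi 1) ℓ) x₀ N := by
  intro aa haa ℓ
  rw [apply_testFun_of_eq_adelicTensorEnd (lineRepOf_two_regime_archToAdelicG V S hGR hGR₀ hGR₁ hGR₂ hGR₃ η₀ η₁ η₂ η₃ hV aa) _ x₀ N,
    LinearMap.smul_apply]
  congr 1
  have h := smul_apply_eq_self_of_places (L : Type) (Matrix.diagonal (frameD V))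
    ((cmArchWeilRep (L : Type) e₁ (frameD V) (frameD_real V) (frameD_ne V) (lineVec (L : Type) (dW' S 0)) (fun _ => dW'_real S 0)
      (fun _ => dW'_ne S 0) hGR₂).comp (MonoidHom.inl _ _))
    (archScalar_twoG V S hGR hGR₂ hGR₃ η₂)
    (blockFamilyOfAt (L : Type) e₁ (frameD V) (frameD_real V) (frameD_ne V) (lineVec (L : Type) (dW' S 0)) (fun _ => dW'_real S 0)
      (fun _ => dW'_ne S 0) ι₁ (blockPosEquiv V) (blockNegEquiv V) eR eS (degOnePDual S') (binvPi 1) ℓ)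
    (UnitaryGroup.cmPlace (L : Type) ι₁) (fun b hb u => by
      rw [MonoidHom.comp_apply, MonoidHom.inl_apply, hω b (ne_cmPlace_of_cmPlaceOver_ne hb) u ℓ, smul_smul,
        hdef b (ne_cmPlace_of_cmPlaceOver_ne hb) u, one_smul])
    (archFrameCongr (L : Type) V.Hm (frameG V) (frameD V) (frame_congr V) aa) (archAt_archFrameCongr_eq_one V haa)
  rw [MonoidHom.comp_apply, MonoidHom.inl_apply] at h
  exact h



/-- **(c5), ANY THIN COSET, FOR LINE 2 FROM THE DEFINITE TYPE OF THE LINE SCALAR.**  If at every real place `b ≠ v₁` the line-2 scalar `c₀ = η₀·χ₀` kills the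
vacuum exponent of the pair `(diag frameD V, ⟨a₀⟩)` there (`c₀((archSingle (w b) u)) · det(u)^{a b} = 1`, with `a` the exponent function of
`exists_defExponent_blockFamilyOfAt`, supplied as the hypothesis `hω`), then every archimedean `aa ∈ U(V.Hm)(L ⊗ ℝ)` with trivial
`w(ι₁)`-component fixes every `φ_N(Φarch ℓ)` under `lineRepD … 0` — LITERALLY the `harch` input of the row-12 term (#CA13–#CA19) for line 2. -/
theorem harch_two_of_defType_cosetG (xc : Fin 3 → FiniteAdeleRing (𝓞 ↥(maximalRealSubfield L)) ↥(maximalRealSubfield L))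
    (𝔫 : Ideal (𝓞 ↥(maximalRealSubfield L)))
    (a : {v : InfinitePlace ↥(maximalRealSubfield L) // v.IsReal} → ℤ)
    (hω : ∀ b : {v : InfinitePlace ↥(maximalRealSubfield L) // v.IsReal}, b ≠ HypCensus.cmPlace (L : Type) ι₁ →
      ∀ (u : UnitaryGroup.archLocal (L : Type) 3 (Matrix.diagonal (frameD V)) (cmPlaceOver (L : Type) b)) (ℓ : Module.Dual ℂ (Fin 2 → ℂ)),
        cmArchWeilRep (L : Type) e₁ (frameD V) (frameD_real V) (frameD_ne V) (lineVec (L : Type) (dW' S 0)) (fun _ => dW'_real S 0)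
            (fun _ => dW'_ne S 0) hGR₂
            (UnitaryGroup.archSingle (↥(maximalRealSubfield L)) L (IsCMField.complexConj L) 3 (Matrix.diagonal (frameD V))
              (IsCMField.complexConj_ne_one L) (NumberField.complexConj_smul_infinitePlace (L : Type)) (cmPlaceOver (L : Type) b) u, 1)
            (blockFamilyOfAt (L : Type) e₁ (frameD V) (frameD_real V) (frameD_ne V) (lineVec (L : Type) (dW' S 0)) (fun _ => dW'_real S 0)
              (fun _ => dW'_ne S 0) ι₁ (blockPosEquiv V) (blockNegEquiv V) eR eS (degOnePDual S') (binvPi 1) ℓ) =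
          (((u : UnitaryGroup.archLocal (L : Type) 3 (Matrix.diagonal (frameD V)) (cmPlaceOver (L : Type) b)) : GL (Fin 3) ℂ) :
              Matrix (Fin 3) (Fin 3) ℂ).det ^ a b •
            blockFamilyOfAt (L : Type) e₁ (frameD V) (frameD_real V) (frameD_ne V) (lineVec (L : Type) (dW' S 0)) (fun _ => dW'_real S 0)
              (fun _ => dW'_ne S 0) ι₁ (blockPosEquiv V) (blockNegEquiv V) eR eS (degOnePDual S') (binvPi 1) ℓ)
    (hdef : ∀ b : {v : InfinitePlace ↥(maximalRealSubfield L) // v.IsReal}, b ≠ HypCensus.cmPlace (L : Type) ι₁ →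
      ∀ u : UnitaryGroup.archLocal (L : Type) 3 (Matrix.diagonal (frameD V)) (cmPlaceOver (L : Type) b),
        ((archScalar_twoG V S hGR hGR₂ hGR₃ η₂
            (UnitaryGroup.archSingle (↥(maximalRealSubfield L)) L (IsCMField.complexConj L) 3 (Matrix.diagonal (frameD V))
              (IsCMField.complexConj_ne_one L) (NumberField.complexConj_smul_infinitePlace (L : Type)) (cmPlaceOver (L : Type) b) u) : ℂˣ) : ℂ) *
          (((u : UnitaryGroup.archLocal (L : Type) 3 (Matrix.diagonal (frameD V)) (cmPlaceOver (L : Type) b)) : GL (Fin 3) ℂ) :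
              Matrix (Fin 3) (Fin 3) ℂ).det ^ a b = 1) :
    ∀ aa : UnitaryGroup.arch (↥(maximalRealSubfield L)) L (IsCMField.complexConj L) 3 V.Hm,
      UnitaryGroup.archAt (↥(maximalRealSubfield L)) L (IsCMField.complexConj L) 3 V.Hm (UnitaryGroup.cmPlace (L : Type) ι₁)
          (NumberField.complexConj_smul_infinitePlace (L : Type) _) (IsCMField.complexConj_ne_one (L : Type)) aa = 1 →
      ∀ ℓ : Module.Dual ℂ (Fin 2 → ℂ),
        lineRepOf V S hGR hGR₀ hGR₁ hGR₂ hGR₃ η₀ η₁ η₂ η₃ 2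
            (HodgeCM.Adelic.regimeEquiv L V.Hm hV
              (UnitaryGroup.archToAdelic (↥(maximalRealSubfield L)) L (IsCMField.complexConj L) 3 V.Hm aa), 1)
            (thinCosetTestFunₗ (K := ↥(maximalRealSubfield L)) (ι := Fin 3) xc 𝔫
              (blockFamilyOfAt (L : Type) e₁ (frameD V) (frameD_real V) (frameD_ne V) (lineVec (L : Type) (dW' S 0)) (fun _ => dW'_real S 0)
                (fun _ => dW'_ne S 0) ι₁ (blockPosEquiv V) (blockNegEquiv V) eR eS (degOnePDual S') (binvPi 1) ℓ)) =
          thinCosetTestFunₗ (K := ↥(maximalRealSubfield L)) (ι := Fin 3) xc 𝔫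
            (blockFamilyOfAt (L : Type) e₁ (frameD V) (frameD_real V) (frameD_ne V) (lineVec (L : Type) (dW' S 0)) (fun _ => dW'_real S 0)
              (fun _ => dW'_ne S 0) ι₁ (blockPosEquiv V) (blockNegEquiv V) eR eS (degOnePDual S') (binvPi 1) ℓ) := by
  intro aa haa ℓ
  rw [apply_thinCosetTestFunₗ_of_eq_adelicTensorEnd (lineRepOf_two_regime_archToAdelicG V S hGR hGR₀ hGR₁ hGR₂ hGR₃ η₀ η₁ η₂ η₃ hV aa) _ xc 𝔫,
    LinearMap.smul_apply]
  congr 1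
  have h := smul_apply_eq_self_of_places (L : Type) (Matrix.diagonal (frameD V))
    ((cmArchWeilRep (L : Type) e₁ (frameD V) (frameD_real V) (frameD_ne V) (lineVec (L : Type) (dW' S 0)) (fun _ => dW'_real S 0)
      (fun _ => dW'_ne S 0) hGR₂).comp (MonoidHom.inl _ _))
    (archScalar_twoG V S hGR hGR₂ hGR₃ η₂)
    (blockFamilyOfAt (L : Type) e₁ (frameD V) (frameD_real V) (frameD_ne V) (lineVec (L : Type) (dW' S 0)) (fun _ => dW'_real S 0)
      (fun _ => dW'_ne S 0) ι₁ (blockPosEquiv V) (blockNegEquiv V) eR eS (degOnePDual S') (binvPi 1) ℓ)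
    (UnitaryGroup.cmPlace (L : Type) ι₁) (fun b hb u => by
      rw [MonoidHom.comp_apply, MonoidHom.inl_apply, hω b (ne_cmPlace_of_cmPlaceOver_ne hb) u ℓ, smul_smul,
        hdef b (ne_cmPlace_of_cmPlaceOver_ne hb) u, one_smul])
    (archFrameCongr (L : Type) V.Hm (frameG V) (frameD V) (frame_congr V) aa) (archAt_archFrameCongr_eq_one V haa)
  rw [MonoidHom.comp_apply, MonoidHom.inl_apply] at h
  exact h

/-! ### line 3 (conjugated plane) -/

/-- **the scalar of line 3 on archimedean elements of `U(diag frameD V)`**: `x ↦ η₃(x^𝔸, 1) · χ₃′(x^𝔸, 1)` (its pull-back along the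
`ι₁`-section `archSectionFrameOf V` is #CA3's `lineScalar_three`). -/
def archScalar_threeG : UnitaryGroup.arch (↥(maximalRealSubfield L)) L (IsCMField.complexConj L) 3 (Matrix.diagonal (frameD V)) →* ℂˣ :=
  (η₃.comp (MonoidHom.prod
      (UnitaryGroup.archToAdelic (↥(maximalRealSubfield L)) L (IsCMField.complexConj L) 3 (Matrix.diagonal (frameD V))) 1)) *
    ((cmConjLineChar₁ (L : Type) finProdFinEquiv e₁ (frameD V) (frameD_real V) (frameD_ne V) (dW S) (dW_real S) (dW_ne S) (dW' S) (dW'_real S) (dW'_ne S) S.isoGL (isoGL_hg₀ S) hGR hGR₂ hGR₃).comp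
      (MonoidHom.prod (UnitaryGroup.archToAdelic (↥(maximalRealSubfield L)) L (IsCMField.complexConj L) 3 (Matrix.diagonal (frameD V))) 1))

/-- (Ported verbatim from the HodgeCMPerL package; no docstring in the source.) -/
theorem archScalar_three_applyG (x : UnitaryGroup.arch (↥(maximalRealSubfield L)) L (IsCMField.complexConj L) 3 (Matrix.diagonal (frameD V))) :
    archScalar_threeG V S hGR hGR₂ hGR₃ η₃ x =
      η₃ (UnitaryGroup.archToAdelic (↥(maximalRealSubfield L)) L (IsCMField.complexConj L) 3 (Matrix.diagonal (frameD V)) x, 1) *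
        cmConjLineChar₁ (L : Type) finProdFinEquiv e₁ (frameD V) (frameD_real V) (frameD_ne V) (dW S) (dW_real S) (dW_ne S) (dW' S) (dW'_real S) (dW'_ne S) S.isoGL (isoGL_hg₀ S) hGR hGR₂ hGR₃
          (UnitaryGroup.archToAdelic (↥(maximalRealSubfield L)) L (IsCMField.complexConj L) 3 (Matrix.diagonal (frameD V)) x, 1) :=
  rfl

/-- **line 3 at an ARCHIMEDEAN regime element**: `lineRepD 0 ((a)^𝔸, 1) = (c₀(a′) • ω_∞((a′, 1))) ⊗ 1`, `a′ = archFrameCongr (frameG V) a`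
(#CA2 `smul_cmPairRep_archToAdelic_eq_adelicTensorEnd` + the line collapse, as in #CA3 for the `ι₁`-section). -/
theorem lineRepOf_three_regime_archToAdelicG (a : UnitaryGroup.arch (↥(maximalRealSubfield L)) L (IsCMField.complexConj L) 3 V.Hm) :
    lineRepOf V S hGR hGR₀ hGR₁ hGR₂ hGR₃ η₀ η₁ η₂ η₃ 3
        (HodgeCM.Adelic.regimeEquiv L V.Hm hV
          (UnitaryGroup.archToAdelic (↥(maximalRealSubfield L)) L (IsCMField.complexConj L) 3 V.Hm a), 1) =
      adelicTensorEnd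
        (((archScalar_threeG V S hGR hGR₂ hGR₃ η₃ (archFrameCongr (L : Type) V.Hm (frameG V) (frameD V) (frame_congr V) a) : ℂˣ) : ℂ) •
          (cmArchWeilRep (L : Type) e₁ (frameD V) (frameD_real V) (frameD_ne V) (lineVec (L : Type) (dW' S 1))
            (fun _ => dW'_real S 1) (fun _ => dW'_ne S 1) hGR₃ (archFrameCongr (L : Type) V.Hm (frameG V) (frameD V) (frame_congr V) a, 1) :
              𝓢((Fin 3 → mixedSpace (↥(maximalRealSubfield L))), ℂ) →ₗ[ℂ] _))
        LinearMap.id := by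
  have h1 : lineRepOf V S hGR hGR₀ hGR₁ hGR₂ hGR₃ η₀ η₁ η₂ η₃ 3
        (HodgeCM.Adelic.regimeEquiv L V.Hm hV
          (UnitaryGroup.archToAdelic (↥(maximalRealSubfield L)) L (IsCMField.complexConj L) 3 V.Hm a), 1) =
      cmConjLineRepFin₁ (L : Type) finProdFinEquiv e₁ (frameD V) (frameD_real V) (frameD_ne V) (dW S) (dW_real S) (dW_ne S) (dW' S) (dW'_real S)
        (dW'_ne S) S.isoGL (isoGL_hg₀ S) hGR hGR₂ hGR₃ η₃
        (UnitaryGroup.archToAdelic (↥(maximalRealSubfield L)) L (IsCMField.complexConj L) 3 (Matrix.diagonal (frameD V))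
          (archFrameCongr (L : Type) V.Hm (frameG V) (frameD V) (frame_congr V) a), 1) := by
    rw [← cmFrameEquiv_regime_archToAdelic V hV a]
    rfl
  have key := smul_cmPairRep_archToAdelic_eq_adelicTensorEnd (L : Type) e₁ (frameD V) (frameD_real V) (frameD_ne V)
    (lineVec (L : Type) (dW' S 1)) (fun _ => dW'_real S 1) (fun _ => dW'_ne S 1) hGR₃
    ((archScalar_threeG V S hGR hGR₂ hGR₃ η₃ (archFrameCongr (L : Type) V.Hm (frameG V) (frameD V) (frame_congr V) a) : ℂˣ) : ℂ)
    (archFrameCongr (L : Type) V.Hm (frameG V) (frameD V) (frame_congr V) a) 1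
  rw [map_one] at key
  rw [h1, ← key]
  refine LinearMap.ext fun φ => ?_
  rw [cmConjLineRepFin₁_apply_eq_smul_cmPairRep, LinearMap.smul_apply, map_one, map_one]
  rfl

variable
  (eR₃ : PosIdx (cmXW (L : Type) (frameD V) (lineVec (L : Type) (dW' S 1)) (fun _ => dW'_real S 1) ι₁ (HypCensus.cmPlace (L : Type) ι₁)) ≃ Unit)
  (eS₃ : NegIdx (cmXW (L : Type) (frameD V) (lineVec (L : Type) (dW' S 1)) (fun _ => dW'_real S 1) ι₁ (HypCensus.cmPlace (L : Type) ι₁)) ≃ S')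

/-- **(c5) FOR LINE 3 FROM THE DEFINITE TYPE OF THE LINE SCALAR.**  If at every real place `b ≠ v₁` the line-3 scalar `c₀ = η₀·χ₀` kills the
vacuum exponent of the pair `(diag frameD V, ⟨a₀⟩)` there (`c₀((archSingle (w b) u)) · det(u)^{a b} = 1`, with `a` the exponent function of
`exists_defExponent_blockFamilyOfAt`, supplied as the hypothesis `hω`), then every archimedean `aa ∈ U(V.Hm)(L ⊗ ℝ)` with trivial
`w(ι₁)`-component fixes every `φ_N(Φarch ℓ)` under `lineRepD … 0` — LITERALLY the `harch` input of the row-12 term (#CA13–#CA19) for line 3. -/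
theorem harch_three_of_defTypeG (x₀ : Fin 3 → ↥(maximalRealSubfield L)) (N : ℕ)
    (a : {v : InfinitePlace ↥(maximalRealSubfield L) // v.IsReal} → ℤ)
    (hω : ∀ b : {v : InfinitePlace ↥(maximalRealSubfield L) // v.IsReal}, b ≠ HypCensus.cmPlace (L : Type) ι₁ →
      ∀ (u : UnitaryGroup.archLocal (L : Type) 3 (Matrix.diagonal (frameD V)) (cmPlaceOver (L : Type) b)) (ℓ : Module.Dual ℂ (Fin 2 → ℂ)),
        cmArchWeilRep (L : Type) e₁ (frameD V) (frameD_real V) (frameD_ne V) (lineVec (L : Type) (dW' S 1)) (fun _ => dW'_real S 1)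
            (fun _ => dW'_ne S 1) hGR₃
            (UnitaryGroup.archSingle (↥(maximalRealSubfield L)) L (IsCMField.complexConj L) 3 (Matrix.diagonal (frameD V))
              (IsCMField.complexConj_ne_one L) (NumberField.complexConj_smul_infinitePlace (L : Type)) (cmPlaceOver (L : Type) b) u, 1)
            (blockFamilyOfAt (L : Type) e₁ (frameD V) (frameD_real V) (frameD_ne V) (lineVec (L : Type) (dW' S 1)) (fun _ => dW'_real S 1)
              (fun _ => dW'_ne S 1) ι₁ (blockPosEquiv V) (blockNegEquiv V) eR₃ eS₃ (degOnePDual S') (binvPi 1) ℓ) =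
          (((u : UnitaryGroup.archLocal (L : Type) 3 (Matrix.diagonal (frameD V)) (cmPlaceOver (L : Type) b)) : GL (Fin 3) ℂ) :
              Matrix (Fin 3) (Fin 3) ℂ).det ^ a b •
            blockFamilyOfAt (L : Type) e₁ (frameD V) (frameD_real V) (frameD_ne V) (lineVec (L : Type) (dW' S 1)) (fun _ => dW'_real S 1)
              (fun _ => dW'_ne S 1) ι₁ (blockPosEquiv V) (blockNegEquiv V) eR₃ eS₃ (degOnePDual S') (binvPi 1) ℓ)
    (hdef : ∀ b : {v : InfinitePlace ↥(maximalRealSubfield L) // v.IsReal}, b ≠ HypCensus.cmPlace (L : Type) ι₁ →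
      ∀ u : UnitaryGroup.archLocal (L : Type) 3 (Matrix.diagonal (frameD V)) (cmPlaceOver (L : Type) b),
        ((archScalar_threeG V S hGR hGR₂ hGR₃ η₃
            (UnitaryGroup.archSingle (↥(maximalRealSubfield L)) L (IsCMField.complexConj L) 3 (Matrix.diagonal (frameD V))
              (IsCMField.complexConj_ne_one L) (NumberField.complexConj_smul_infinitePlace (L : Type)) (cmPlaceOver (L : Type) b) u) : ℂˣ) : ℂ) *
          (((u : UnitaryGroup.archLocal (L : Type) 3 (Matrix.diagonal (frameD V)) (cmPlaceOver (L : Type) b)) : GL (Fin 3) ℂ) :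
              Matrix (Fin 3) (Fin 3) ℂ).det ^ a b = 1) :
    ∀ aa : UnitaryGroup.arch (↥(maximalRealSubfield L)) L (IsCMField.complexConj L) 3 V.Hm,
      UnitaryGroup.archAt (↥(maximalRealSubfield L)) L (IsCMField.complexConj L) 3 V.Hm (UnitaryGroup.cmPlace (L : Type) ι₁)
          (NumberField.complexConj_smul_infinitePlace (L : Type) _) (IsCMField.complexConj_ne_one (L : Type)) aa = 1 →
      ∀ ℓ : Module.Dual ℂ (Fin 2 → ℂ),
        lineRepOf V S hGR hGR₀ hGR₁ hGR₂ hGR₃ η₀ η₁ η₂ η₃ 3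
            (HodgeCM.Adelic.regimeEquiv L V.Hm hV
              (UnitaryGroup.archToAdelic (↥(maximalRealSubfield L)) L (IsCMField.complexConj L) 3 V.Hm aa), 1)
            (testFun (↥(maximalRealSubfield L)) (Fin 3)
              (blockFamilyOfAt (L : Type) e₁ (frameD V) (frameD_real V) (frameD_ne V) (lineVec (L : Type) (dW' S 1)) (fun _ => dW'_real S 1)
                (fun _ => dW'_ne S 1) ι₁ (blockPosEquiv V) (blockNegEquiv V) eR₃ eS₃ (degOnePDual S') (binvPi 1) ℓ) x₀ N) =
          testFun (↥(maximalRealSubfield L)) (Fin 3)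
            (blockFamilyOfAt (L : Type) e₁ (frameD V) (frameD_real V) (frameD_ne V) (lineVec (L : Type) (dW' S 1)) (fun _ => dW'_real S 1)
              (fun _ => dW'_ne S 1) ι₁ (blockPosEquiv V) (blockNegEquiv V) eR₃ eS₃ (degOnePDual S') (binvPi 1) ℓ) x₀ N := by
  intro aa haa ℓ
  rw [apply_testFun_of_eq_adelicTensorEnd (lineRepOf_three_regime_archToAdelicG V S hGR hGR₀ hGR₁ hGR₂ hGR₃ η₀ η₁ η₂ η₃ hV aa) _ x₀ N,
    LinearMap.smul_apply]
  congr 1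
  have h := smul_apply_eq_self_of_places (L : Type) (Matrix.diagonal (frameD V))
    ((cmArchWeilRep (L : Type) e₁ (frameD V) (frameD_real V) (frameD_ne V) (lineVec (L : Type) (dW' S 1)) (fun _ => dW'_real S 1)
      (fun _ => dW'_ne S 1) hGR₃).comp (MonoidHom.inl _ _))
    (archScalar_threeG V S hGR hGR₂ hGR₃ η₃)
    (blockFamilyOfAt (L : Type) e₁ (frameD V) (frameD_real V) (frameD_ne V) (lineVec (L : Type) (dW' S 1)) (fun _ => dW'_real S 1)
      (fun _ => dW'_ne S 1) ι₁ (blockPosEquiv V) (blockNegEquiv V) eR₃ eS₃ (degOnePDual S') (binvPi 1) ℓ)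
    (UnitaryGroup.cmPlace (L : Type) ι₁) (fun b hb u => by
      rw [MonoidHom.comp_apply, MonoidHom.inl_apply, hω b (ne_cmPlace_of_cmPlaceOver_ne hb) u ℓ, smul_smul,
        hdef b (ne_cmPlace_of_cmPlaceOver_ne hb) u, one_smul])
    (archFrameCongr (L : Type) V.Hm (frameG V) (frameD V) (frame_congr V) aa) (archAt_archFrameCongr_eq_one V haa)
  rw [MonoidHom.comp_apply, MonoidHom.inl_apply] at h
  exact h



/-- **(c5), ANY THIN COSET, FOR LINE 3 FROM THE DEFINITE TYPE OF THE LINE SCALAR.**  If at every real place `b ≠ v₁` the line-3 scalar `c₀ = η₀·χ₀` kills the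
vacuum exponent of the pair `(diag frameD V, ⟨a₀⟩)` there (`c₀((archSingle (w b) u)) · det(u)^{a b} = 1`, with `a` the exponent function of
`exists_defExponent_blockFamilyOfAt`, supplied as the hypothesis `hω`), then every archimedean `aa ∈ U(V.Hm)(L ⊗ ℝ)` with trivial
`w(ι₁)`-component fixes every `φ_N(Φarch ℓ)` under `lineRepD … 0` — LITERALLY the `harch` input of the row-12 term (#CA13–#CA19) for line 3. -/
theorem harch_three_of_defType_cosetG (xc : Fin 3 → FiniteAdeleRing (𝓞 ↥(maximalRealSubfield L)) ↥(maximalRealSubfield L))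
    (𝔫 : Ideal (𝓞 ↥(maximalRealSubfield L)))
    (a : {v : InfinitePlace ↥(maximalRealSubfield L) // v.IsReal} → ℤ)
    (hω : ∀ b : {v : InfinitePlace ↥(maximalRealSubfield L) // v.IsReal}, b ≠ HypCensus.cmPlace (L : Type) ι₁ →
      ∀ (u : UnitaryGroup.archLocal (L : Type) 3 (Matrix.diagonal (frameD V)) (cmPlaceOver (L : Type) b)) (ℓ : Module.Dual ℂ (Fin 2 → ℂ)),
        cmArchWeilRep (L : Type) e₁ (frameD V) (frameD_real V) (frameD_ne V) (lineVec (L : Type) (dW' S 1)) (fun _ => dW'_real S 1)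
            (fun _ => dW'_ne S 1) hGR₃
            (UnitaryGroup.archSingle (↥(maximalRealSubfield L)) L (IsCMField.complexConj L) 3 (Matrix.diagonal (frameD V))
              (IsCMField.complexConj_ne_one L) (NumberField.complexConj_smul_infinitePlace (L : Type)) (cmPlaceOver (L : Type) b) u, 1)
            (blockFamilyOfAt (L : Type) e₁ (frameD V) (frameD_real V) (frameD_ne V) (lineVec (L : Type) (dW' S 1)) (fun _ => dW'_real S 1)
              (fun _ => dW'_ne S 1) ι₁ (blockPosEquiv V) (blockNegEquiv V) eR₃ eS₃ (degOnePDual S') (binvPi 1) ℓ) =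
          (((u : UnitaryGroup.archLocal (L : Type) 3 (Matrix.diagonal (frameD V)) (cmPlaceOver (L : Type) b)) : GL (Fin 3) ℂ) :
              Matrix (Fin 3) (Fin 3) ℂ).det ^ a b •
            blockFamilyOfAt (L : Type) e₁ (frameD V) (frameD_real V) (frameD_ne V) (lineVec (L : Type) (dW' S 1)) (fun _ => dW'_real S 1)
              (fun _ => dW'_ne S 1) ι₁ (blockPosEquiv V) (blockNegEquiv V) eR₃ eS₃ (degOnePDual S') (binvPi 1) ℓ)
    (hdef : ∀ b : {v : InfinitePlace ↥(maximalRealSubfield L) // v.IsReal}, b ≠ HypCensus.cmPlace (L : Type) ι₁ →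
      ∀ u : UnitaryGroup.archLocal (L : Type) 3 (Matrix.diagonal (frameD V)) (cmPlaceOver (L : Type) b),
        ((archScalar_threeG V S hGR hGR₂ hGR₃ η₃
            (UnitaryGroup.archSingle (↥(maximalRealSubfield L)) L (IsCMField.complexConj L) 3 (Matrix.diagonal (frameD V))
              (IsCMField.complexConj_ne_one L) (NumberField.complexConj_smul_infinitePlace (L : Type)) (cmPlaceOver (L : Type) b) u) : ℂˣ) : ℂ) *
          (((u : UnitaryGroup.archLocal (L : Type) 3 (Matrix.diagonal (frameD V)) (cmPlaceOver (L : Type) b)) : GL (Fin 3) ℂ) :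
              Matrix (Fin 3) (Fin 3) ℂ).det ^ a b = 1) :
    ∀ aa : UnitaryGroup.arch (↥(maximalRealSubfield L)) L (IsCMField.complexConj L) 3 V.Hm,
      UnitaryGroup.archAt (↥(maximalRealSubfield L)) L (IsCMField.complexConj L) 3 V.Hm (UnitaryGroup.cmPlace (L : Type) ι₁)
          (NumberField.complexConj_smul_infinitePlace (L : Type) _) (IsCMField.complexConj_ne_one (L : Type)) aa = 1 →
      ∀ ℓ : Module.Dual ℂ (Fin 2 → ℂ),
        lineRepOf V S hGR hGR₀ hGR₁ hGR₂ hGR₃ η₀ η₁ η₂ η₃ 3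
            (HodgeCM.Adelic.regimeEquiv L V.Hm hV
              (UnitaryGroup.archToAdelic (↥(maximalRealSubfield L)) L (IsCMField.complexConj L) 3 V.Hm aa), 1)
            (thinCosetTestFunₗ (K := ↥(maximalRealSubfield L)) (ι := Fin 3) xc 𝔫
              (blockFamilyOfAt (L : Type) e₁ (frameD V) (frameD_real V) (frameD_ne V) (lineVec (L : Type) (dW' S 1)) (fun _ => dW'_real S 1)
                (fun _ => dW'_ne S 1) ι₁ (blockPosEquiv V) (blockNegEquiv V) eR₃ eS₃ (degOnePDual S') (binvPi 1) ℓ)) =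
          thinCosetTestFunₗ (K := ↥(maximalRealSubfield L)) (ι := Fin 3) xc 𝔫
            (blockFamilyOfAt (L : Type) e₁ (frameD V) (frameD_real V) (frameD_ne V) (lineVec (L : Type) (dW' S 1)) (fun _ => dW'_real S 1)
              (fun _ => dW'_ne S 1) ι₁ (blockPosEquiv V) (blockNegEquiv V) eR₃ eS₃ (degOnePDual S') (binvPi 1) ℓ) := by
  intro aa haa ℓ
  rw [apply_thinCosetTestFunₗ_of_eq_adelicTensorEnd (lineRepOf_three_regime_archToAdelicG V S hGR hGR₀ hGR₁ hGR₂ hGR₃ η₀ η₁ η₂ η₃ hV aa) _ xc 𝔫,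
    LinearMap.smul_apply]
  congr 1
  have h := smul_apply_eq_self_of_places (L : Type) (Matrix.diagonal (frameD V))
    ((cmArchWeilRep (L : Type) e₁ (frameD V) (frameD_real V) (frameD_ne V) (lineVec (L : Type) (dW' S 1)) (fun _ => dW'_real S 1)
      (fun _ => dW'_ne S 1) hGR₃).comp (MonoidHom.inl _ _))
    (archScalar_threeG V S hGR hGR₂ hGR₃ η₃)
    (blockFamilyOfAt (L : Type) e₁ (frameD V) (frameD_real V) (frameD_ne V) (lineVec (L : Type) (dW' S 1)) (fun _ => dW'_real S 1)
      (fun _ => dW'_ne S 1) ι₁ (blockPosEquiv V) (blockNegEquiv V) eR₃ eS₃ (degOnePDual S') (binvPi 1) ℓ)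
    (UnitaryGroup.cmPlace (L : Type) ι₁) (fun b hb u => by
      rw [MonoidHom.comp_apply, MonoidHom.inl_apply, hω b (ne_cmPlace_of_cmPlaceOver_ne hb) u ℓ, smul_smul,
        hdef b (ne_cmPlace_of_cmPlaceOver_ne hb) u, one_smul])
    (archFrameCongr (L : Type) V.Hm (frameG V) (frameD V) (frame_congr V) aa) (archAt_archFrameCongr_eq_one V haa)
  rw [MonoidHom.comp_apply, MonoidHom.inl_apply] at h
  exact h

end HarchPinChar

end HodgeCM.Model

end
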